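import Summits.AnomalousDissipation.AnomalousDissipation.Theorems.MomentLadder.Negative.Clauses
import Literature.Analysis.FunctionSpaces.TorusEnstrophyTrilinear
import Literature.Analysis.FunctionSpaces.TorusTruncationH1
import Literature.Analysis.FluidPDE.ZerothLaw

/-!
# Weight stationarity: stub `stub_weightStationarity` (A2c) of line `Sketch`
# (crux `MomentParity.MomentLadder`, stmt-AnomalousDissipation-11463)

Sorry-free discharge of the registered stub `stub_weightStationarity` of the lead's skeleton over the
landed vocabulary (`IsBandTest`, `polyGrad`, `IsPolyStationary` of
`Theorems/QuarticGate/Negative/LevelCeiling.lean`; `IsSupported` and the Bernstein bound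
`eGradNormSq_fourierTruncate_le_sq_mul` of `Theorems/MomentLadder/Negative/Clauses.lean`).

**Statement.** Assume (A2a, a hypothesis here) that for every level `N` and every real polynomial `p`
there is an admissible polynomial cylindrical test `(g, P)` with `∇P(u) = 2 p'(Z(P_N u)) · (−Δ P_N u)`
for all `u ∈ H` (`Z = ‖∇·‖²` spectral, `P_N` the Fourier truncation). Then for a finite law `μ` on `H`
supported in the ball `‖u‖ ≤ R` and polynomially stationary at every degree, the row
`G(u) = ⟨F(u), −ΔP_N u⟩` is `μ`-integrable and `∫ G(u) / (1 + Z(P_N u))² dμ = 0`: stationarity passes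
from the polynomial observables `p(Z)` to the non-polynomial weight `−1/(1+Z)`.

**Proof.** (0) The generator pairing `⟨F(u), w⟩` is homogeneous in the smooth test field `w`
(`stub_weightStationarity_aux_pairing_const_smul`, copied from the tree's
`nsGeneratorPairing_smul_fourierTruncate`), so the stationarity rows read
`∫ 2 p'(Z_N u) G(u) dμ = 0` with integrable integrands, for every real polynomial `p`.
(1) `p = X` gives `G ∈ L¹(μ)`. (2) Bernstein confines `Z_N u = ‖∇P_N u‖²` to `[0, 4π²N²R²]` for
`μ`-a.e. `u`; Weierstrass (Mathlib `exists_polynomial_near_of_continuousOn`) gives polynomials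
`q_n → (1+z)⁻²` uniformly there, and polynomial antiderivatives `p_n' = q_n` feed (0).
(3) Dominated convergence (`|q_n| ≤ 2` on the interval, dominating function `4|G|`) passes to the
limit in the zero rows. Steps (1)–(3) are the abstract, torus-free
`stub_weightStationarity_aux_of_polynomial_rows` (any measure space).

References: Foias–Manley–Rosa–Temam, *Navier–Stokes Equations and Turbulence* (CUP 2001), Ch. IV
§1.1–1.2 ((1.11): `(F(u), v)` is linear in the test field; stationary statistical solutions);
Weierstrass approximation theorem (Mathlib `Mathlib/Topology/ContinuousMap/Weierstrass.lean`);
Lebesgue dominated convergence (Mathlib `MeasureTheory.tendsto_integral_of_dominated_convergence`).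
-/

set_option linter.dupNamespace false

noncomputable section

namespace Summit.AnomalousDissipation.AnomalousDissipation.Theorems.MomentLadder

open MeasureTheory Filter Topology Set
open scoped ENNReal NNReal InnerProductSpace RealInnerProductSpace Polynomial
open Literature.Analysis.FunctionSpaces Literature.Analysis.FluidPDE
open Summit.AnomalousDissipation.AnomalousDissipation.Theses.MomentParity
open Summit.AnomalousDissipation.AnomalousDissipation.Theorems.QuarticGate.Negative
open Summit.AnomalousDissipation.AnomalousDissipation.Theorems.MomentLadder.Negative

/-! ## Step 0: homogeneity of the generator pairing in a smooth test field -/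

/-- **Homogeneity of the generator pairing in the test field**: for a smooth field `w` on `T^d` and a
real scalar `c`, `⟨F(u), c w⟩ = c ⟨F(u), w⟩` for every `u ∈ H` (FMRT 2001, Ch. IV (1.11): `(F(u), v)`
is linear in `v`; here all derivatives sit on the smooth `w`, and `Δ(cw) = cΔw`, `∇(cw) = c∇w`).
Copied from the tree's `Torus.nsGeneratorPairing_smul_fourierTruncate` with `P_m u` replaced by an
arbitrary smooth field. [folklore] -/
theorem stub_weightStationarity_aux_pairing_const_smul {d : Type*} [Fintype d] [DecidableEq d]
    (ν : ℝ) (f : UnitAddTorus d → EuclideanSpace ℝ d) (u : Torus.energySpace d)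
    {w : UnitAddTorus d → EuclideanSpace ℝ d} (hw : Torus.IsSmooth w) (c : ℝ) :
    Torus.nsGeneratorPairing ν f u (fun x => c • w x) = c * Torus.nsGeneratorPairing ν f u w := by
  -- adapted from `Literature.Analysis.FluidPDE.Torus.nsGeneratorPairing_smul_fourierTruncate`
  rw [Torus.nsGeneratorPairing, Torus.nsGeneratorPairing, Torus.inertialPairing,
    Torus.inertialPairing]
  -- the Laplacian is homogeneous: `Δ(c w) = c Δw`
  have hlap : ∀ x, Torus.laplacian (fun y => c • w y) x = c • Torus.laplacian w x := by
    intro x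
    have hcw : Torus.IsSmooth (fun y => c • w y) := hw.smul c
    rw [Torus.laplacian_eq_sum_partialDeriv_partialDeriv hcw,
      Torus.laplacian_eq_sum_partialDeriv_partialDeriv hw, Finset.smul_sum]
    refine Finset.sum_congr rfl fun i _ => ?_
    have h1 : Torus.partialDeriv i (fun y => c • w y) = c • Torus.partialDeriv i w :=
      Torus.partialDeriv_const_smul (hw.isContDiff (by simp)) c i
    rw [h1, Torus.partialDeriv_const_smul ((hw.partialDeriv i).isContDiff (by simp)) c i,
      Pi.smul_apply]
  simp_rw [hlap, real_inner_smul_right, integral_const_mul]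
  -- the Fréchet derivative is homogeneous: `∇(c w) = c ∇w`
  have hfd : ∀ x a, Torus.fderiv (fun y => c • w y) x a = c • Torus.fderiv w x a := by
    intro x a
    have h := Torus.fderiv_const_smul (hw.isContDiff (by simp)) c x
    rw [show (c • w) = fun y => c • w y from rfl] at h
    rw [h]
    rfl
  simp_rw [hfd, real_inner_smul_left, integral_const_mul]
  ring

/-- The Stokes-weighted truncation test field `−Δ P_N v` is smooth (it is a real trigonometric
polynomial). [folklore] -/
theorem stub_weightStationarity_aux_isSmooth_testField (N : ℕ)
    (v : UnitAddTorus (Fin 3) → EuclideanSpace ℝ (Fin 3)) :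
    Torus.IsSmooth (fun x => -(Torus.laplacian (Torus.fourierTruncate N v) x)) :=
  ((Torus.isSmooth_fourierTruncate N v).laplacian).neg

/-! ## Steps 1–3: polynomial antiderivatives, Weierstrass, dominated convergence -/

/-- Real polynomials have polynomial antiderivatives. [folklore] -/
private theorem exists_derivative_eq (q : ℝ[X]) : ∃ p : ℝ[X], Polynomial.derivative p = q := by
  -- adapted from `Literature.Analysis.Complex.exists_polynomial_derivative_eq`
  induction q using Polynomial.induction_on' with
  | add p q hp hq =>
    obtain ⟨p', hp'⟩ := hp
    obtain ⟨q', hq'⟩ := hq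
    exact ⟨p' + q', by rw [Polynomial.derivative_add, hp', hq']⟩
  | monomial n a =>
    refine ⟨Polynomial.monomial (n + 1) (a / ((n : ℝ) + 1)), ?_⟩
    rw [Polynomial.derivative_monomial_succ, div_mul_cancel₀ _ (Nat.cast_add_one_ne_zero n)]

/-- **From polynomial rows to the weight `(1+Z)⁻²`** (abstract Weierstrass + dominated convergence
step, on any measure space). If a real observable `Z` is a.e. confined to `[0, L]` and the "rows"
`u ↦ 2 p'(Z u) G(u)` are integrable with zero integral for EVERY real polynomial `p`, then `G` is
integrable (`p = X`) and `∫ G(u) / (1 + Z u)² dμ = 0`: approximate `z ↦ (1+z)⁻²` uniformly on `[0, L]`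
by polynomials `q_n` (Weierstrass), realise `q_n = p_n'`, and pass to the limit in the zero rows by
dominated convergence with dominating function `4|G|` (`|q_n| ≤ 2` on `[0, L]`). [folklore] -/
theorem stub_weightStationarity_aux_of_polynomial_rows {α : Type*} [MeasurableSpace α]
    {μ : Measure α} {Z G : α → ℝ} {L : ℝ} (hZ : ∀ᵐ u ∂μ, Z u ∈ Icc 0 L)
    (hrow : ∀ p : ℝ[X],
      Integrable (fun u => 2 * (Polynomial.derivative p).eval (Z u) * G u) μ ∧
        ∫ u, 2 * (Polynomial.derivative p).eval (Z u) * G u ∂μ = 0) :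
    Integrable G μ ∧ ∫ u, ((1 + Z u) ^ 2)⁻¹ * G u ∂μ = 0 := by
  -- Step 1: `G ∈ L¹` from the row `p = X` (`p' = 1`).
  have hG : Integrable G μ := by
    have h := (hrow Polynomial.X).1
    simp only [Polynomial.derivative_X, Polynomial.eval_one, mul_one] at h
    exact (integrable_const_mul_iff (isUnit_iff_ne_zero.2 two_ne_zero) G).1 h
  refine ⟨hG, ?_⟩
  -- Step 2: Weierstrass on `[0, L]` for the weight `z ↦ (1+z)⁻²`, and antiderivatives.
  have hcont : ContinuousOn (fun z : ℝ => ((1 + z) ^ 2)⁻¹) (Icc 0 L) := by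
    refine ContinuousOn.inv₀ (by fun_prop) fun z hz => ?_
    have : 0 < 1 + z := by linarith [hz.1]
    positivity
  have hW : ∀ n : ℕ, ∃ q : ℝ[X], ∀ z ∈ Icc (0 : ℝ) L,
      |q.eval z - ((1 + z) ^ 2)⁻¹| < 1 / ((n : ℝ) + 1) := fun n =>
    exists_polynomial_near_of_continuousOn 0 L (fun z => ((1 + z) ^ 2)⁻¹) hcont _
      Nat.one_div_pos_of_nat
  choose q hq using hW
  have hanti : ∀ n : ℕ, ∃ p : ℝ[X], Polynomial.derivative p = q n := fun n =>
    exists_derivative_eq (q n)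
  choose p hp using hanti
  -- the rows of the antiderivatives: `∫ 2 q_n(Z) G dμ = 0`, integrands integrable
  have hrowq : ∀ n, Integrable (fun u => 2 * (q n).eval (Z u) * G u) μ ∧
      ∫ u, 2 * (q n).eval (Z u) * G u ∂μ = 0 := fun n => by
    have h := hrow (p n)
    rwa [hp n] at h
  -- uniform bound `|q_n| ≤ 2` on `[0, L]` (`0 ≤ (1+z)⁻² ≤ 1` there)
  have hqbd : ∀ n, ∀ z ∈ Icc (0 : ℝ) L, |(q n).eval z| ≤ 2 := by
    intro n z hz
    have hφ0 : 0 ≤ ((1 + z) ^ 2)⁻¹ := by positivity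
    have hφ1 : ((1 + z) ^ 2)⁻¹ ≤ 1 := inv_le_one_of_one_le₀ (by nlinarith [hz.1])
    have hn : (0 : ℝ) ≤ n := n.cast_nonneg
    have h1 : |(q n).eval z - ((1 + z) ^ 2)⁻¹| ≤ 1 :=
      (hq n z hz).le.trans (by rw [div_le_one (by positivity)]; linarith)
    calc |(q n).eval z| = |((q n).eval z - ((1 + z) ^ 2)⁻¹) + ((1 + z) ^ 2)⁻¹| := by
          rw [sub_add_cancel]
      _ ≤ |(q n).eval z - ((1 + z) ^ 2)⁻¹| + |((1 + z) ^ 2)⁻¹| := abs_add_le _ _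
      _ ≤ 1 + 1 := add_le_add h1 (by rwa [abs_of_nonneg hφ0])
      _ = 2 := by norm_num
  -- Step 3: dominated convergence in the zero rows.
  have hlim : Tendsto (fun n => ∫ u, 2 * (q n).eval (Z u) * G u ∂μ) atTop
      (𝓝 (∫ u, 2 * ((1 + Z u) ^ 2)⁻¹ * G u ∂μ)) := by
    refine tendsto_integral_of_dominated_convergence (fun u => 4 * |G u|)
      (fun n => (hrowq n).1.aestronglyMeasurable) (hG.abs.const_mul 4) (fun n => ?_) ?_
    · refine hZ.mono fun u hu => ?_
      rw [Real.norm_eq_abs, abs_mul, abs_mul, abs_two]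
      have hq2 := hqbd n (Z u) hu
      have hG0 := abs_nonneg (G u)
      nlinarith [mul_nonneg (sub_nonneg.2 hq2) hG0]
    · refine hZ.mono fun u hu => ?_
      have hconv : Tendsto (fun n => (q n).eval (Z u)) atTop (𝓝 ((1 + Z u) ^ 2)⁻¹) := by
        rw [tendsto_iff_dist_tendsto_zero]
        refine squeeze_zero (fun n => dist_nonneg) (fun n => ?_)
          tendsto_one_div_add_atTop_nhds_zero_nat
        rw [Real.dist_eq]
        exact (hq n (Z u) hu).le
      exact (hconv.const_mul 2).mul_const (G u)
  have hzero : ∫ u, 2 * ((1 + Z u) ^ 2)⁻¹ * G u ∂μ = 0 := by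
    refine tendsto_nhds_unique hlim ?_
    have h0 : (fun n => ∫ u, 2 * (q n).eval (Z u) * G u ∂μ) = fun _ => 0 :=
      funext fun n => (hrowq n).2
    rw [h0]
    exact tendsto_const_nhds
  have h2 : ∫ u, 2 * ((1 + Z u) ^ 2)⁻¹ * G u ∂μ = 2 * ∫ u, ((1 + Z u) ^ 2)⁻¹ * G u ∂μ := by
    rw [← integral_const_mul]
    refine integral_congr_ae (ae_of_all _ fun u => ?_)
    ring
  rw [h2] at hzero
  linarith

/-! ## The stub -/

/-- **STUB A2c of line `Sketch` (weight stationarity), discharged.** Assume (A2a) that for every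
level `N` and every real polynomial `p` there is an admissible polynomial cylindrical test `(g, P)`
(band tests `g`, polynomial `P`) with `∇P(u) = 2 p'(Z(P_N u)) · (−Δ P_N u)` for all `u ∈ H`. Then for
every viscosity `ν`, force `f`, level `N`, radius `R` and finite law `μ` on `H = L²_σ(T³)` that is
supported in `‖u‖ ≤ R` and polynomially stationary for Galerkin NS at `(ν, f)` at every degree, the
row `u ↦ ⟨F(u), −ΔP_N u⟩` is `μ`-integrable and `∫ ⟨F(u), −ΔP_N u⟩ / (1 + Z(P_N u))² dμ = 0`
(FMRT 2001, Ch. IV §1.2: stationarity `∫ ⟨F(u), Φ'(u)⟩ dμ = 0` of the observables `Φ = p(Z ∘ P_N)`,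
extended from polynomial `p` to `p(z) = −1/(1+z)` by Weierstrass on `[0, 4π²N²R²]` (Bernstein:
`Z(P_N u) ≤ 4π²N²‖u‖²`) and dominated convergence, with the `p = X` row as dominating function).
[folklore] -/
theorem stub_weightStationarity :
    (∀ (N : ℕ) (p : ℝ[X]), ∃ (m : ℕ) (g : Fin m → UnitAddTorus (Fin 3) → EuclideanSpace ℝ (Fin 3))
      (P : MvPolynomial (Fin m) ℝ), (∀ i, IsBandTest N (g i)) ∧
      ∀ u : Torus.energySpace (Fin 3), polyGrad g P u = fun x =>
        (2 * (Polynomial.derivative p).eval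
          (Torus.eGradNormSq (Torus.fourierTruncate N
            (u.1 : UnitAddTorus (Fin 3) → EuclideanSpace ℝ (Fin 3)))).toReal) •
          (-(Torus.laplacian (Torus.fourierTruncate N
            (u.1 : UnitAddTorus (Fin 3) → EuclideanSpace ℝ (Fin 3))) x))) →
    ∀ (ν : ℝ) (f : UnitAddTorus (Fin 3) → EuclideanSpace ℝ (Fin 3)) (N : ℕ) (R : ℝ)
      (μ : Measure (Torus.energySpace (Fin 3))) [IsFiniteMeasure μ],
      IsSupported R μ → (∀ d, IsPolyStationary ν f N d μ) →
      Integrable (fun u : Torus.energySpace (Fin 3) => Torus.nsGeneratorPairing ν f u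
          (fun x => -(Torus.laplacian (Torus.fourierTruncate N
            (u.1 : UnitAddTorus (Fin 3) → EuclideanSpace ℝ (Fin 3))) x))) μ ∧
      ∫ u, ((1 + (Torus.eGradNormSq (Torus.fourierTruncate N
            (u.1 : UnitAddTorus (Fin 3) → EuclideanSpace ℝ (Fin 3)))).toReal) ^ 2)⁻¹ *
          Torus.nsGeneratorPairing ν f u (fun x => -(Torus.laplacian (Torus.fourierTruncate N
            (u.1 : UnitAddTorus (Fin 3) → EuclideanSpace ℝ (Fin 3))) x)) ∂μ = 0 := by
  intro hA ν f N R μ _ hsupp hstat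
  refine stub_weightStationarity_aux_of_polynomial_rows (μ := μ)
    (Z := fun u : Torus.energySpace (Fin 3) => (Torus.eGradNormSq (Torus.fourierTruncate N
      (u.1 : UnitAddTorus (Fin 3) → EuclideanSpace ℝ (Fin 3)))).toReal)
    (G := fun u : Torus.energySpace (Fin 3) => Torus.nsGeneratorPairing ν f u
      (fun x => -(Torus.laplacian (Torus.fourierTruncate N
        (u.1 : UnitAddTorus (Fin 3) → EuclideanSpace ℝ (Fin 3))) x)))
    (L := 4 * Real.pi ^ 2 * (N : ℝ) ^ 2 * R ^ 2) ?_ ?_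
  · -- Bernstein: `Z(P_N u) ≤ 4π²N²‖u‖² ≤ 4π²N²R²` for `μ`-a.e. `u`
    refine Filter.Eventually.mono hsupp fun u hu => ⟨ENNReal.toReal_nonneg, ?_⟩
    have hB := eGradNormSq_fourierTruncate_le_sq_mul N u.1
    have hnorm : ‖u.1‖ₑ ^ 2 = ENNReal.ofReal (‖u‖ ^ 2) := by
      rw [← ofReal_norm, ← ENNReal.ofReal_pow (norm_nonneg _), Submodule.coe_norm]
    rw [hnorm, ← ENNReal.ofReal_mul (by positivity)] at hB
    have h1 := ENNReal.toReal_mono ENNReal.ofReal_ne_top hB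
    rw [ENNReal.toReal_ofReal (by positivity)] at h1
    refine h1.trans ?_
    have hR : ‖u‖ ^ 2 ≤ R ^ 2 := pow_le_pow_left₀ (norm_nonneg _) hu 2
    exact mul_le_mul_of_nonneg_left hR (by positivity)
  · -- the rows: `∇P = 2 p'(Z_N) · A_N` (A2a), homogeneity of the pairing, stationarity at degree
    -- `P.totalDegree + 1`
    intro p
    obtain ⟨m, g, P, hg, hP⟩ := hA N p
    obtain ⟨hint, hzero⟩ := hstat (P.totalDegree + 1) m g P hg le_rfl
    have hfun : ∀ u : Torus.energySpace (Fin 3),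
        Torus.nsGeneratorPairing ν f u (polyGrad g P u) =
          2 * (Polynomial.derivative p).eval (Torus.eGradNormSq (Torus.fourierTruncate N
            (u.1 : UnitAddTorus (Fin 3) → EuclideanSpace ℝ (Fin 3)))).toReal *
          Torus.nsGeneratorPairing ν f u (fun x => -(Torus.laplacian (Torus.fourierTruncate N
            (u.1 : UnitAddTorus (Fin 3) → EuclideanSpace ℝ (Fin 3))) x)) := fun u => by
      rw [hP u]
      exact stub_weightStationarity_aux_pairing_const_smul ν f u
        (stub_weightStationarity_aux_isSmooth_testField N _) _
    refine ⟨hint.congr (ae_of_all _ hfun), ?_⟩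
    rwa [integral_congr_ae (ae_of_all _ hfun)] at hzero

end Summit.AnomalousDissipation.AnomalousDissipation.Theorems.MomentLadder

end
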